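import Literature.MathematicalPhysics.QuantumFieldTheory.Balaban1983to89.B8Prop5ContractionKLevel
import Literature.MathematicalPhysics.QuantumFieldTheory.Balaban1983to89.B8TorusShiftStencils

/-!
# `Balaban1983to89.B8Prop5NeumannPeriodic` — [Balaban1985RegularSpaces] (1.88), (1.93)–(1.96) p. 91–92 ON THE TORUS: the source `W`, the
# multiplier `V_{λ′}` and the Neumann solution `Z = (I + V R)⁻¹W` of Proposition 5 are `P`-PERIODIC for periodic data (sub-row «G-B8-T2S»,
# RULING #4 v3, layer 3(d) prerequisites of `lit-balaban-t2s-1/g2/V3-DESIGN.md`)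

statement-level skeleton of published theorems with citation tags; proofs where landed; nothing here is a claim about the
Yang–Mills mass gap

T. Bałaban, *Spaces of regular gauge field configurations on a lattice and gauge fixing conditions*, Commun. Math. Phys. **99** (1985) 75–102
`[Balaban1985RegularSpaces]` ("B8"): (1.1)–(1.2) p. 76, (1.88) p. 91, (1.93)–(1.96) p. 92, §3 p. 98 («on the torus … periodic configurations»).
STATUS: published, refereed.

CITATION HEADER (lean-in-tree rule).  Cell `lit-balaban`, seat `lit-balaban-t2s-1` (gen 2).  WHAT IS PROVED (0 sorry, no `def`): translation
covariance of the local expressions of (1.88) — `frakF3_shiftCfg`, `Vop_shiftCfg`, `Wsrc_shiftCfg` (after `B8TorusShiftStencils.covDerivFwd_shiftCfg` &c.)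
— and the periodicity consequences under a `P`-periodic background `U₀`, bond field `A` and periodic arguments: `covDerivFwd_per`, `covDeriv_per`,
`covDivB_per`, `frakF3_per` (`covLap_per` is `B8Thm2TorusLettersPerConv.covLap_per`), `Vop_per`, `Wsrc_per`; the Picard iterates and the Neumann solution of (1.96): `zseq_per`, `zsol_per`
(for `W` periodic and `V`, `R` periodicity-preserving); `psiP5_per` (`Ψλ = R(−Z_λ)` periodic).  Print: §3 p. 98 runs §1–§2 on periodic
configurations; these are the bookkeeping identities that make the periodic subspace invariant.

HONEST SCOPE.  Elementary identities; count-neutral; N05 ∕ `stub_PV3A` NOT discharged; nothing continuum ∕ ℝ⁴ ∕ OS ∕ mass-gap ∕ Clay — the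
Yang–Mills mass gap is NOT proved.  No `sorry`, no `def`, no `… : Prop` fact, no `instance`, no `notation`.
-/

noncomputable section

open NormedSpace Metric Set Filter Topology
open Complex (I)
open scoped BigOperators

namespace Literature.MathematicalPhysics.QuantumFieldTheory.Balaban1983to89.B8Prop5NeumannPeriodic

open B7Prop1Explicit (e expUnit)
open B7Eq78Linearization (conjR)
open B8Ineq132 (covDerivFwd covDeriv)
open B8Eq138LandauZd (covLap covDivB)
open B8Eq182Proof (gAd frakF1 frakF2)
open B8Eq184Proof (gaugeExp)
open B8Eq188Proof (frakF3)
open B8Prop5ContractionKLevel (Zseq Zsol Vop Wsrc PsiP5 zseq_zero zseq_succ)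
open B12Ineq417Flat (shiftCfg shiftCfg_apply)
open B8TorusShiftStencils (covDerivFwd_shiftCfg covDeriv_shiftCfg covDivB_shiftCfg covLap_shiftCfg)

-- `Site` alone could resolve to the torus sites of `Setup.lean`; re-export the `ℤ^d` sites of `B7Prop1Explicit`.
export B7Prop1Explicit (Site)

variable {d : ℕ} {𝔸 : Type*} [NormedRing 𝔸] [NormedAlgebra ℂ 𝔸] [CompleteSpace 𝔸]

/-! ## §1 Translation covariance of the local expressions of (1.88) -/

section Shift

/-- **`𝔉₃,μ` of (1.88) is translation covariant.** [cite: Balaban1985RegularSpaces, (1.88) p.91, (1.1)–(1.2) p.76] -/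
theorem frakF3_shiftCfg (η : ℝ) (a : Site d) (V : Site d → Fin d → 𝔸ˣ) (lam : Site d → 𝔸) (A : Site d → Fin d → 𝔸) (x : Site d)
    (μ : Fin d) : frakF3 η (shiftCfg a V) (shiftCfg a lam) (shiftCfg a A) x μ = frakF3 η V lam A (x + a) μ := by
  simp only [frakF3, covDerivFwd_shiftCfg, covDeriv_shiftCfg, shiftCfg_apply, add_sub_right_comm x a (e μ)]

/-- **`V_a` of (1.94) is translation covariant** (a sitewise expression). [cite: Balaban1985RegularSpaces, (1.94) p.92] -/
theorem Vop_shiftCfg (a : Site d) (lam f : Site d → 𝔸) (x : Site d) : Vop (shiftCfg a lam) (shiftCfg a f) x = Vop lam f (x + a) := by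
  simp only [Vop, shiftCfg_apply]

/-- **The source `W` of (1.93)–(1.95) is translation covariant.** [cite: Balaban1985RegularSpaces, (1.88) p.91, (1.93)–(1.95) p.92] -/
theorem Wsrc_shiftCfg (η : ℝ) (a : Site d) (V : Site d → Fin d → 𝔸ˣ) (A : Site d → Fin d → 𝔸) (DA lam E : Site d → 𝔸) (x : Site d) :
    Wsrc η (shiftCfg a V) (shiftCfg a A) (shiftCfg a DA) (shiftCfg a lam) (shiftCfg a E) x = Wsrc η V A DA lam E (x + a) := by
  simp only [Wsrc, gaugeExp, frakF3_shiftCfg, shiftCfg_apply]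

end Shift

/-! ## §2 Periodicity under a periodic background -/

section Periodic

variable {η : ℝ} {U₀ : Site d → Fin d → 𝔸ˣ} {A : Site d → Fin d → 𝔸} {P : ℤ}

omit [CompleteSpace 𝔸] in
/-- A `P`-periodic function is its own shift by `P·e_i`. [cite: Balaban1985RegularSpaces, §3 p.98] -/
theorem shiftCfg_eq_of_per {β : Type*} {F : Site d → β} (hF : ∀ (z : Site d) (i : Fin d), F (z + P • e i) = F z) (i : Fin d) :
    shiftCfg (P • e i) F = F := by
  funext z; exact hF z i

omit [CompleteSpace 𝔸] in
/-- **`D^η_{U₀,μ}f` is periodic** for periodic `U₀`, `f`. [cite: Balaban1985RegularSpaces, (1.1) p.76, §3 p.98] -/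
theorem covDerivFwd_per (hU₀ : ∀ (z : Site d) (i : Fin d), U₀ (z + P • e i) = U₀ z) {f : Site d → 𝔸}
    (hf : ∀ (z : Site d) (i : Fin d), f (z + P • e i) = f z) (μ : Fin d) :
    ∀ (z : Site d) (i : Fin d), covDerivFwd η U₀ μ f (z + P • e i) = covDerivFwd η U₀ μ f z := by
  intro z i
  rw [← covDerivFwd_shiftCfg η (P • e i) U₀ μ f z, shiftCfg_eq_of_per hU₀ i, shiftCfg_eq_of_per hf i]

omit [CompleteSpace 𝔸] in
/-- **`D^{η*}_{U₀,μ}f` is periodic** for periodic `U₀`, `f`. [cite: Balaban1985RegularSpaces, (1.2) p.76, §3 p.98] -/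
theorem covDeriv_per (hU₀ : ∀ (z : Site d) (i : Fin d), U₀ (z + P • e i) = U₀ z) {f : Site d → 𝔸}
    (hf : ∀ (z : Site d) (i : Fin d), f (z + P • e i) = f z) (μ : Fin d) :
    ∀ (z : Site d) (i : Fin d), covDeriv η U₀ μ f (z + P • e i) = covDeriv η U₀ μ f z := by
  intro z i
  rw [← covDeriv_shiftCfg η (P • e i) U₀ μ f z, shiftCfg_eq_of_per hU₀ i, shiftCfg_eq_of_per hf i]

omit [CompleteSpace 𝔸] in
/-- **`D^{η*}_{U₀}B` is periodic** for periodic `U₀`, `B`. [cite: Balaban1985BackgroundPropagators, (3.23) p.394; Balaban1985RegularSpaces, §3 p.98] -/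
theorem covDivB_per (hU₀ : ∀ (z : Site d) (i : Fin d), U₀ (z + P • e i) = U₀ z) {B : Site d → Fin d → 𝔸}
    (hB : ∀ (z : Site d) (i : Fin d), B (z + P • e i) = B z) :
    ∀ (z : Site d) (i : Fin d), covDivB η U₀ B (z + P • e i) = covDivB η U₀ B z := by
  intro z i
  rw [← covDivB_shiftCfg η (P • e i) U₀ B z, shiftCfg_eq_of_per hU₀ i, shiftCfg_eq_of_per hB i]

/-- **`𝔉₃,μ(λ, A)` is periodic** for periodic `U₀`, `λ`, `A`. [cite: Balaban1985RegularSpaces, (1.88) p.91, §3 p.98] -/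
theorem frakF3_per (hU₀ : ∀ (z : Site d) (i : Fin d), U₀ (z + P • e i) = U₀ z) (hA : ∀ (z : Site d) (i : Fin d), A (z + P • e i) = A z)
    {lam : Site d → 𝔸} (hlam : ∀ (z : Site d) (i : Fin d), lam (z + P • e i) = lam z) (μ : Fin d) :
    ∀ (z : Site d) (i : Fin d), frakF3 η U₀ lam A (z + P • e i) μ = frakF3 η U₀ lam A z μ := by
  intro z i
  rw [← frakF3_shiftCfg η (P • e i) U₀ lam A z μ, shiftCfg_eq_of_per hU₀ i, shiftCfg_eq_of_per hlam i, shiftCfg_eq_of_per hA i]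

/-- **`V_{λ′}f` is periodic** for periodic `λ′`, `f`. [cite: Balaban1985RegularSpaces, (1.94) p.92, §3 p.98] -/
theorem Vop_per {lam : Site d → 𝔸} (hlam : ∀ (z : Site d) (i : Fin d), lam (z + P • e i) = lam z) {f : Site d → 𝔸}
    (hf : ∀ (z : Site d) (i : Fin d), f (z + P • e i) = f z) :
    ∀ (z : Site d) (i : Fin d), Vop lam f (z + P • e i) = Vop lam f z := by
  intro z i
  simp only [Vop, hlam z i, hf z i]

/-- **The source `W` is periodic** for periodic `U₀`, `A`, `D*A`, `λ′`, `E`. [cite: Balaban1985RegularSpaces, (1.93)–(1.95) p.92, §3 p.98] -/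
theorem Wsrc_per (hU₀ : ∀ (z : Site d) (i : Fin d), U₀ (z + P • e i) = U₀ z) (hA : ∀ (z : Site d) (i : Fin d), A (z + P • e i) = A z)
    {DA lam E : Site d → 𝔸} (hDA : ∀ (z : Site d) (i : Fin d), DA (z + P • e i) = DA z)
    (hlam : ∀ (z : Site d) (i : Fin d), lam (z + P • e i) = lam z) (hE : ∀ (z : Site d) (i : Fin d), E (z + P • e i) = E z) :
    ∀ (z : Site d) (i : Fin d), Wsrc η U₀ A DA lam E (z + P • e i) = Wsrc η U₀ A DA lam E z := by
  intro z i
  rw [← Wsrc_shiftCfg η (P • e i) U₀ A DA lam E z, shiftCfg_eq_of_per hU₀ i, shiftCfg_eq_of_per hA i, shiftCfg_eq_of_per hDA i,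
    shiftCfg_eq_of_per hlam i, shiftCfg_eq_of_per hE i]

omit [NormedAlgebra ℂ 𝔸] [CompleteSpace 𝔸] in
/-- **The Picard iterates of (1.96) are periodic** when `W` is and `V`, `R` preserve periodicity. [cite: Balaban1985RegularSpaces, (1.96) p.92, §3 p.98] -/
theorem zseq_per {W : Site d → 𝔸} {V R : (Site d → 𝔸) → (Site d → 𝔸)} (hW : ∀ (z : Site d) (i : Fin d), W (z + P • e i) = W z)
    (hV : ∀ f : Site d → 𝔸, (∀ (z : Site d) (i : Fin d), f (z + P • e i) = f z) → ∀ (z : Site d) (i : Fin d), V f (z + P • e i) = V f z)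
    (hR : ∀ f : Site d → 𝔸, (∀ (z : Site d) (i : Fin d), f (z + P • e i) = f z) → ∀ (z : Site d) (i : Fin d), R f (z + P • e i) = R f z)
    (n : ℕ) : ∀ (z : Site d) (i : Fin d), Zseq W V R n (z + P • e i) = Zseq W V R n z := by
  induction n with
  | zero => intro z i; rw [zseq_zero]; exact hW z i
  | succ n ih => intro z i; rw [zseq_succ, zseq_succ, hW z i, hV _ (hR _ ih) z i]

omit [NormedAlgebra ℂ 𝔸] [CompleteSpace 𝔸] in
/-- **The Neumann solution `Z = (I + VR)⁻¹W` of (1.96) is periodic** when `W` is and `V`, `R` preserve periodicity (the pointwise limit of periodic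
iterates). [cite: Balaban1985RegularSpaces, (1.96) p.92, §3 p.98] -/
theorem zsol_per {W : Site d → 𝔸} {V R : (Site d → 𝔸) → (Site d → 𝔸)} (hW : ∀ (z : Site d) (i : Fin d), W (z + P • e i) = W z)
    (hV : ∀ f : Site d → 𝔸, (∀ (z : Site d) (i : Fin d), f (z + P • e i) = f z) → ∀ (z : Site d) (i : Fin d), V f (z + P • e i) = V f z)
    (hR : ∀ f : Site d → 𝔸, (∀ (z : Site d) (i : Fin d), f (z + P • e i) = f z) → ∀ (z : Site d) (i : Fin d), R f (z + P • e i) = R f z) :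
    ∀ (z : Site d) (i : Fin d), Zsol W V R (z + P • e i) = Zsol W V R z := by
  intro z i
  simp only [Zsol]
  congr 1
  funext n
  exact zseq_per hW hV hR n z i

omit [NormedAlgebra ℂ 𝔸] [CompleteSpace 𝔸] in
/-- **`Ψλ = R(−Z_λ)` of (1.99)–(1.100) is periodic** at a `λ` with periodic data `W_λ`, `V_{λ′}` (and `R` periodicity-preserving).
[cite: Balaban1985RegularSpaces, (1.99)–(1.100) p.93, §3 p.98] -/
theorem neg_zsol_per {W : Site d → 𝔸} {V R : (Site d → 𝔸) → (Site d → 𝔸)} (hW : ∀ (z : Site d) (i : Fin d), W (z + P • e i) = W z)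
    (hV : ∀ f : Site d → 𝔸, (∀ (z : Site d) (i : Fin d), f (z + P • e i) = f z) → ∀ (z : Site d) (i : Fin d), V f (z + P • e i) = V f z)
    (hR : ∀ f : Site d → 𝔸, (∀ (z : Site d) (i : Fin d), f (z + P • e i) = f z) → ∀ (z : Site d) (i : Fin d), R f (z + P • e i) = R f z) :
    ∀ (z : Site d) (i : Fin d), R (fun x => -Zsol W V R x) (z + P • e i) = R (fun x => -Zsol W V R x) z :=
  hR _ fun z i => by simp only [zsol_per hW hV hR z i]

end Periodic

#print axioms Wsrc_shiftCfg
#print axioms zsol_per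

end Literature.MathematicalPhysics.QuantumFieldTheory.Balaban1983to89.B8Prop5NeumannPeriodic

end
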